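import Mathlib
import Summits.NavierStokesRegularity.NavierStokesRegularity.Theorems.FilamentSkeletonRssStadiumKernelPieces
import Literature.Analysis.Complex.HolomorphicParametricIntegral

/-!
# Route `FilamentSkeletonRss` · child crux `TangentSkeletonNearStraightL` (stmt-NavierStokesRegularity-23320) · registered line
# `child_tangent_analytic_strip_L` (b0b56c52900dd90a), stub `stub_stripPropagation` — brick: THE UNSHIFTED (FAR / PARTNER) PIECE IS HOLOMORPHIC

Second assembly step of R7 (STUB-PLAN memo attached to 23320).  For an UNSHIFTED real source curve `X : ℝ → ℝ³` (`C¹`; the partner filament, or the own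
filament outside the shifted window) with continuous core area `A`, and the complex target `F(z)` (`F` holomorphic on an open `V`), the piece
`z ↦ ∫_{σ ∈ T} ((Σᵢ(Fᵢ(z) − Xᵢ(σ))² + κA(σ))^{3/2})⁻¹ • (cplx X′(σ) ⨯₃ (F(z) − cplx X(σ))) dσ`
over a measurable parameter set `T` is holomorphic on `V` provided the principal-branch condition holds on `V × T`
(`Theorems.StadiumVerticalDisplacement` / `Theorems.StadiumFarKernelBound`) and the integrand has a `z`-uniform integrable majorant on `T`
(`Theorems.StadiumFarMajorant`: the Lorentzian): `differentiableOn_farPiece`, by the tree's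
`Literature.Analysis.Complex.HolomorphicParametricIntegral.differentiableOn_integral_of_dominated`.
HONEST FRAMING: a brick for a plan about a HYPOTHETICAL filament skeleton on the NEGATIVE side of a MODEL route; the stub `stub_stripPropagation` is NOT
closed; nothing here bears on Navier–Stokes regularity or blow-up.  `--supports stmt-NavierStokesRegularity-23320`.
-/

set_option linter.dupNamespace false

noncomputable section

namespace Summit.NavierStokesRegularity.NavierStokesRegularity.Theorems.StadiumFarPieceHolomorphic

open Set Filter Topology Complex MeasureTheory Metric
open scoped Matrix

/-- **The unshifted piece is holomorphic.**  See the module docstring. [folklore] -/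
theorem differentiableOn_farPiece {V : Set ℂ} (hV : IsOpen V) {F : ℂ → (Fin 3 → ℂ)} (hF : DifferentiableOn ℂ F V)
    {X : ℝ → EuclideanSpace ℝ (Fin 3)} (hX : ContDiff ℝ 1 X) {A : ℝ → ℝ} (hA : Continuous A) {κ : ℝ}
    {T : Set ℝ} (hT : MeasurableSet T)
    (hpos : ∀ z ∈ V, ∀ σ ∈ T, 0 < ((∑ i, (F z i - ((X σ i : ℝ) : ℂ)) ^ 2) + ((κ * A σ : ℝ) : ℂ)).re)
    {bound : ℝ → ℝ} (hbound : IntegrableOn bound T)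
    (hdom : ∀ z ∈ V, ∀ σ ∈ T,
      ‖(((∑ i, (F z i - ((X σ i : ℝ) : ℂ)) ^ 2) + ((κ * A σ : ℝ) : ℂ)) ^ ((3:ℂ) / 2))⁻¹ •
        ((fun i => ((deriv X σ i : ℝ) : ℂ)) ⨯₃ (fun i => F z i - ((X σ i : ℝ) : ℂ)))‖ ≤ bound σ) :
    DifferentiableOn ℂ (fun z => ∫ σ in T,
      (((∑ i, (F z i - ((X σ i : ℝ) : ℂ)) ^ 2) + ((κ * A σ : ℝ) : ℂ)) ^ ((3:ℂ) / 2))⁻¹ •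
        ((fun i => ((deriv X σ i : ℝ) : ℂ)) ⨯₃ (fun i => F z i - ((X σ i : ℝ) : ℂ)))) V := by
  set W : ℂ → ℝ → ℂ := fun z σ => (∑ i, (F z i - ((X σ i : ℝ) : ℂ)) ^ 2) + ((κ * A σ : ℝ) : ℂ) with hW
  set Num : ℂ → ℝ → (Fin 3 → ℂ) := fun z σ =>
    (fun i => ((deriv X σ i : ℝ) : ℂ)) ⨯₃ (fun i => F z i - ((X σ i : ℝ) : ℂ)) with hNum
  -- continuity in `σ` of the real data
  have hXc : Continuous X := hX.continuous
  have hdXc : Continuous (deriv X) := hX.continuous_deriv le_rfl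
  have hofLp : Continuous (@WithLp.ofLp 2 (Fin 3 → ℝ)) := PiLp.continuous_ofLp 2 (fun _ : Fin 3 => ℝ)
  have hXo : Continuous fun σ => WithLp.ofLp (X σ) := hofLp.comp hXc
  have hdXo : Continuous fun σ => WithLp.ofLp (deriv X σ) := hofLp.comp hdXc
  have hXi : ∀ i, Continuous fun σ => ((X σ i : ℝ) : ℂ) := fun i =>
    Complex.continuous_ofReal.comp ((continuous_apply i).comp hXo)
  have hdXi : ∀ i, Continuous fun σ => ((deriv X σ i : ℝ) : ℂ) := fun i =>
    Complex.continuous_ofReal.comp ((continuous_apply i).comp hdXo)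
  -- cross product of continuous / constant coordinate functions is continuous (coordinate polynomials)
  have hcrossc : ∀ (a b : ℝ → (Fin 3 → ℂ)), Continuous a → Continuous b → Continuous fun σ => a σ ⨯₃ b σ := by
    intro a b ha hb
    have hai : ∀ i, Continuous fun x => a x i := fun i => (continuous_apply i).comp ha
    have hbi : ∀ i, Continuous fun x => b x i := fun i => (continuous_apply i).comp hb
    refine continuous_pi fun i => ?_
    fin_cases i
    · simpa [cross_apply, Pi.mul_def, Pi.sub_def] using ((hai 1).mul (hbi 2)).sub ((hai 2).mul (hbi 1))
    · simpa [cross_apply, Pi.mul_def, Pi.sub_def] using ((hai 2).mul (hbi 0)).sub ((hai 0).mul (hbi 2))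
    · simpa [cross_apply, Pi.mul_def, Pi.sub_def] using ((hai 0).mul (hbi 1)).sub ((hai 1).mul (hbi 0))
  -- for fixed `z`: continuity of `σ ↦ K z σ` on `T`
  have hKcont : ∀ z ∈ V, ContinuousOn (fun σ => ((W z σ) ^ ((3:ℂ) / 2))⁻¹ • Num z σ) T := by
    intro z hz
    have hWσ : Continuous (W z) := by
      have h1 : ∀ i, Continuous fun σ => (F z i - ((X σ i : ℝ) : ℂ)) ^ 2 := fun i => (continuous_const.sub (hXi i)).pow 2
      exact (continuous_finsetSum _ fun i _ => h1 i).add (Complex.continuous_ofReal.comp (continuous_const.mul hA))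
    have hNσ : Continuous (Num z) := hcrossc _ _ (continuous_pi fun i => hdXi i) (continuous_pi fun i => continuous_const.sub (hXi i))
    intro σ hσ
    have hc : ContinuousAt (fun w : ℂ => (w ^ ((3:ℂ) / 2))⁻¹) (W z σ) :=
      (Summit.NavierStokesRegularity.NavierStokesRegularity.Theorems.StadiumKernelPieces.differentiableAt_inv_cpow_threeHalves (hpos z hz σ hσ)).continuousAt
    exact ((ContinuousAt.comp_continuousWithinAt (f := W z) hc hWσ.continuousWithinAt).smul hNσ.continuousWithinAt)
  -- for fixed `σ ∈ T`: holomorphy of `z ↦ K z σ` on `V`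
  have hKdiff : ∀ σ ∈ T, DifferentiableOn ℂ (fun z => ((W z σ) ^ ((3:ℂ) / 2))⁻¹ • Num z σ) V := by
    intro σ hσ
    have hFi : ∀ i, DifferentiableOn ℂ (fun z => F z i - ((X σ i : ℝ) : ℂ)) V := fun i => (differentiableOn_pi.1 hF i).sub_const _
    have hWd : DifferentiableOn ℂ (fun z => W z σ) V :=
      (DifferentiableOn.fun_sum fun i _ => (hFi i).pow 2).add_const _
    have hpow : DifferentiableOn ℂ (fun z => ((W z σ) ^ ((3:ℂ) / 2))⁻¹) V := by
      intro z hz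
      exact DifferentiableAt.comp_differentiableWithinAt (g := fun w : ℂ => (w ^ ((3:ℂ) / 2))⁻¹) (f := fun z => W z σ) z
        (Summit.NavierStokesRegularity.NavierStokesRegularity.Theorems.StadiumKernelPieces.differentiableAt_inv_cpow_threeHalves (hpos z hz σ hσ))
        (hWd z hz)
    have hNd : DifferentiableOn ℂ (fun z => Num z σ) V := by
      have hai : ∀ i, DifferentiableOn ℂ (fun _ : ℂ => ((deriv X σ i : ℝ) : ℂ)) V := fun i => differentiableOn_const _
      refine differentiableOn_pi.2 fun i => ?_
      fin_cases i
      · simpa [hNum, cross_apply, Pi.mul_def, Pi.sub_def] using ((hai 1).mul (hFi 2)).sub ((hai 2).mul (hFi 1))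
      · simpa [hNum, cross_apply, Pi.mul_def, Pi.sub_def] using ((hai 2).mul (hFi 0)).sub ((hai 0).mul (hFi 2))
      · simpa [hNum, cross_apply, Pi.mul_def, Pi.sub_def] using ((hai 0).mul (hFi 1)).sub ((hai 1).mul (hFi 0))
    exact hpow.smul hNd
  -- the dominated holomorphic integral
  refine Literature.Analysis.Complex.differentiableOn_integral_of_dominated (μ := volume.restrict T) ?_ ?_ ?_
  · intro z hz
    exact (hKcont z hz).aestronglyMeasurable hT
  · exact ae_restrict_of_forall_mem hT fun σ hσ => hKdiff σ hσ
  · intro x₀ hx₀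
    obtain ⟨r, hr, hrV⟩ := Metric.isOpen_iff.1 hV x₀ hx₀
    refine ⟨r, hr, hrV, bound, hbound, ?_⟩
    exact ae_restrict_of_forall_mem hT fun σ hσ p hp => hdom p (hrV hp) σ hσ

end Summit.NavierStokesRegularity.NavierStokesRegularity.Theorems.StadiumFarPieceHolomorphic

end
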